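/-
HONEST FRAMING: certified error envelopes and provably optimal rounding/accumulation schemes for
low-precision formats under stated cost models; every table by two implementations; no hardware
or vendor claims.
-/
import Summits.Ventures.CertifiedArithmetic.LowPrec.OptDemotionRoutingCfgTop
import Summits.Ventures.CertifiedArithmetic.LowPrec.OptDemotionRoutingBranchU

/-!
# The demotion law (Theorem T8), part 11-4: the auxiliary rows `Φ(S; e)` FOR EVERY CONFIGURATION `S` and every `q`

The Φ-half of the Φ-hierarchy (lean seat gen 14/15, HOME E-SIDE-TOPLEVEL.md §1–§3): for every
precision `q`, every `e ≤ -2`, every nonempty set `S` of exponents in `[1-q, e-1]` and every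
summation tree `t`,

  `Φ(S; e):  2·BR_t({-1} ∪ S) ≤ (1-u)·BR_t({0} ∪ S) + BR_t({e-q, -q} ∪ S) + u·BR_t({e-q} ∪ S)`

(`treeBR_phi_all`; `u = 2^-q`).  In the top-normalised offset language of opt / parts 10i–10l
(`P = -S ⊆ [3, q-1]`, `j = -e`, `p₁ = min P`, `w = 2^-p₁`, `c = q - p₁`, `P' = (P ∖ p₁) - p₁`) this is
`x_(P-1) ≤ (1-u) x_P + w·[x_(P' ∪ {c, c+j}) + u·x_(P' ∪ {c+j})]`: `|S| = 1` is opt's LEMMA Φ3 (part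
10i-b `treeBR_phi3`), `|S| = 2` is LEMMA Φ3′ (part 10k-b `treeBR_phi3p`); here EVERY popcount.
PROOF: strong induction on `S` (strict subsets), inside a tree induction; at a node the node rule
(part 11-2 `treeBR_node_le_top` at top `-1`) leaves one inequality per kept set `K ⊆ S` and
orientation, settled by the four branch certificates of part 11-3 (`phiU_all`: `K = S`, the tree
induction hypothesis; `phiU_empty`: `K = ∅`, the one-regime hard branch — (MC) at `{-1-q} ∪ S`, gap
convexity `e-q < -1-q < -q` below `S`, two (M) rows; `phiU_top`: `max S ∈ K ⊊ S`, `Φ(K; e)` by the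
set induction + LEMMA B1 below the complement; `phiU_low`: `max S ∉ K ≠ ∅`, `Φ(K; max S)` + B1),
fed with the injected options of the three right-hand coordinates (part 11-2
`injected_le_treeBR_node_top` at tops `0`, `max S`, `max S`).  Exact cross-check of the whole scheme
for every `S`, `q ≤ 14`: HOME code/lean/rows_g14/cert_hierarchy.py (8099 instances, 0 failures).
-/

namespace Summit.Ventures.CertifiedArithmetic.LowPrec.Opt

open Literature.ComputerArithmetic.JeannerodRump2018
open Literature.ComputerArithmetic.JeannerodRump2018.SumTree

section PhiAll

variable {q : ℕ}

/-! ## Set identities of the node step and row shapes -/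

/-- Complement of a kept set containing the top, two extra bits. -/
theorem sdiff_keep_top₂ {S P : Finset ℤ} {s a b : ℤ} (hs : s ∈ P) (ha : a ∉ S) (hb : b ∉ S) :
    insert a (insert b (S.erase s)) \ insert a (insert b (P.erase s)) = S \ P := by grind

/-- Complement of a kept set containing the top, one extra bit. -/
theorem sdiff_keep_top₁ {S P : Finset ℤ} {s a : ℤ} (hs : s ∈ P) (ha : a ∉ S) :
    insert a (S.erase s) \ insert a (P.erase s) = S \ P := by grind

/-- Complement of a kept complement (top not kept), two extra bits. -/
theorem sdiff_drop_top₂ {S P : Finset ℤ} {s a b : ℤ} (hs : s ∉ P) (hP : P ⊆ S) (ha : a ∉ S) (hb : b ∉ S)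
    (hab : a ≠ b) : insert a (insert b (S.erase s)) \ insert a ((S \ P).erase s) = insert b P := by grind

/-- Complement of a kept complement (top not kept), one extra bit. -/
theorem sdiff_drop_top₁ {S P : Finset ℤ} {s a : ℤ} (hs : s ∉ P) (hP : P ⊆ S) (ha : a ∉ S) :
    insert a (S.erase s) \ insert a ((S \ P).erase s) = P := by grind

/-- Complement of a kept complement without extra bit. -/
theorem sdiff_drop_top₀ {S P : Finset ℤ} {s b : ℤ} (hs : s ∉ P) (hP : P ⊆ S) (hb : b ∉ S) :
    insert b (S.erase s) \ ((S \ P).erase s) = insert b P := by grind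

/-- Row shape: `2a ≤ b + c` as a nonnegative linear form. -/
theorem row_of_le2 {a b c : ℚ} (h : 2 * a ≤ b + c) : 0 ≤ -2 * a + b + c := by linarith

/-- Row shape: `a ≤ b` as a nonnegative linear form. -/
theorem row_of_le {a b : ℚ} (h : a ≤ b) : 0 ≤ -a + b := by linarith

/-- Row shape of an `E`-row. -/
theorem rowE_of_le {u a b c : ℚ} (h : 2 * a ≤ (1 - u) * b + (1 + u) * c) :
    0 ≤ -2 * a + (1 - u) * b + (1 + u) * c := by linarith

/-- Row shape of a `Φ`-row. -/
theorem rowPhi_of_le {u a b c d : ℚ} (h : 2 * a ≤ (1 - u) * b + c + u * d) :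
    0 ≤ -2 * a + (1 - u) * b + c + u * d := by linarith

/-! ## The theorem -/

/-- **THE AUXILIARY ROWS `Φ(S; e)` FOR EVERY CONFIGURATION** (E-SIDE-TOPLEVEL.md, THEOREM Φ): for
`e ≤ -2`, a nonempty set `S` of exponents in `[1-q, e-1]` and every tree,
`2·BR({-1} ∪ S) ≤ (1-u)·BR({0} ∪ S) + BR({e-q, -q} ∪ S) + u·BR({e-q} ∪ S)`. -/
theorem treeBR_phi_all (S : Finset ℤ) :
    ∀ (e : ℤ), e ≤ -2 → (∀ s ∈ S, 1 - (q : ℤ) ≤ s ∧ s + 1 ≤ e) → S.Nonempty → ∀ t : SumTree,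
      2 * treeBR q t (insert (-1) S) ≤
        (1 - unitRoundoff q) * treeBR q t (insert 0 S) +
          treeBR q t (insert (e - q) (insert (-(q : ℤ)) S)) +
            unitRoundoff q * treeBR q t (insert (e - q) S) := by
  classical
  induction S using Finset.strongInduction with
  | H S ihS =>
  intro e he hS hne
  ------------------------------------------------------------------ the top of `S` and the scalars
  obtain ⟨s₁, hs₁S, hs₁max⟩ : ∃ s₁ ∈ S, ∀ s ∈ S, s ≤ s₁ :=
    ⟨S.max' hne, Finset.max'_mem _ _, fun s hs => Finset.le_max' _ _ hs⟩
  have hs₁ := hS s₁ hs₁S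
  have hq1 : 1 ≤ q := by omega
  set u := unitRoundoff q with hudef
  set w : ℚ := (2 : ℚ) ^ s₁ with hwdef
  set τ : ℚ := (2 : ℚ) ^ e with hτdef
  have huz : u = (2 : ℚ) ^ (-(q : ℤ)) := unitRoundoff_eq_zpow q
  have hu0 : 0 < u := by rw [huz]; exact zpow_pos (by norm_num) _
  have hu1 : u ≤ 1 := unitRoundoff_le_one q
  have hw0 : 0 < w := zpow_pos (by norm_num) _
  have hτ0 : 0 < τ := zpow_pos (by norm_num) _
  have two_mul_zpow : ∀ x : ℤ, (2 : ℚ) * (2 : ℚ) ^ x = (2 : ℚ) ^ (x + 1) := fun x => by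
    rw [zpow_add_one₀ (by norm_num)]; ring
  have pw : ∀ a b : ℤ, (2 : ℚ) ^ (a + b) = (2 : ℚ) ^ a * (2 : ℚ) ^ b := fun a b =>
    zpow_add₀ (by norm_num) a b
  have hwu : 2 * u ≤ w := by
    rw [huz, hwdef, two_mul_zpow]; exact zpow_le_zpow_right₀ (by norm_num) (by omega)
  have hτw : 2 * w ≤ τ := by
    rw [hτdef, hwdef, two_mul_zpow]; exact zpow_le_zpow_right₀ (by norm_num) (by omega)
  have hτ4 : τ ≤ 1 / 4 := by
    rw [hτdef, show (1 / 4 : ℚ) = (2 : ℚ) ^ (-2 : ℤ) by norm_num]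
    exact zpow_le_zpow_right₀ (by norm_num) he
  have p_half : (2 : ℚ) ^ (-1 : ℤ) = 1 / 2 := by norm_num
  have p_m1q : (2 : ℚ) ^ (-1 - (q : ℤ)) = u / 2 := by
    rw [huz, show -1 - (q : ℤ) = -(q : ℤ) + -1 by ring, pw]; norm_num; ring
  have p_s₁q : (2 : ℚ) ^ (s₁ - (q : ℤ)) = w * u := by rw [huz, hwdef, sub_eq_add_neg, pw]
  have p_eq : (2 : ℚ) ^ (e - (q : ℤ)) = τ * u := by rw [huz, hτdef, sub_eq_add_neg, pw]
  -- nonnegativity and the symmetric node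
  have n0 : ∀ (X : SumTree) (T : Finset ℤ), 0 ≤ treeBR q X T := fun X T => treeBR_nonneg q X T
  ------------------------------------------------------------------ the tree induction
  intro tr
  induction tr with
  | leaf z => simp [treeBR]
  | node A B ihA ihB =>
  -- the three right-hand node values
  set NS := treeBR q (.node A B) (insert 0 S) with hNS
  set N2 := treeBR q (.node A B) (insert (e - q) (insert (-(q : ℤ)) S)) with hN2
  set N3 := treeBR q (.node A B) (insert (e - q) S) with hN3
  set T2 : Finset ℤ := insert (e - q) (insert (-(q : ℤ)) (S.erase s₁)) with hT2
  set T3 : Finset ℤ := insert (e - q) (S.erase s₁) with hT3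
  have hT2top : insert s₁ T2 = insert (e - q) (insert (-(q : ℤ)) S) := (insert_insert_eq S hs₁S _ _).symm
  have hT3top : insert s₁ T3 = insert (e - q) S := (insert_negq_eq S hs₁S _).symm
  have hS0 : ∀ t ∈ S, (0 : ℤ) + 1 - (q : ℤ) ≤ t ∧ t + 1 ≤ 0 := fun t ht => by have := hS t ht; omega
  have hSm1 : ∀ t ∈ S, (-1 : ℤ) + 1 - (q : ℤ) ≤ t ∧ t + 1 ≤ -1 := fun t ht => by have := hS t ht; omega
  have hT2b : ∀ t ∈ T2, s₁ + 1 - (q : ℤ) ≤ t ∧ t + 1 ≤ s₁ := by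
    intro t ht
    rcases Finset.mem_insert.1 ht with rfl | ht
    · omega
    rcases Finset.mem_insert.1 ht with rfl | ht
    · omega
    have ht' := Finset.mem_erase.1 ht
    have := hS t ht'.2
    have := hs₁max t ht'.2
    omega
  have hT3b : ∀ t ∈ T3, s₁ + 1 - (q : ℤ) ≤ t ∧ t + 1 ≤ s₁ := by
    intro t ht
    rcases Finset.mem_insert.1 ht with rfl | ht
    · omega
    have ht' := Finset.mem_erase.1 ht
    have := hS t ht'.2
    have := hs₁max t ht'.2
    omega
  -- the injected options of the right-hand coordinates (both orientations)
  have oS : ∀ (X Y : SumTree), treeBR q (.node X Y) (insert 0 S) = NS → ∀ P, P ⊆ S →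
      1 + (treeBR q X (insert 0 P) + treeBR q Y (insert (-(q : ℤ)) (S \ P))) ≤ NS := by
    intro X Y hN P hP
    have h := injected_le_treeBR_node_top hq1 X Y (e₀ := 0) (T := S) hS0 hP
    rw [zpow_zero, zero_sub, hN] at h
    exact h
  have o2 : ∀ (X Y : SumTree), treeBR q (.node X Y) (insert s₁ T2) = N2 → ∀ P, P ⊆ T2 →
      w + (treeBR q X (insert s₁ P) + treeBR q Y (insert (s₁ - q) (T2 \ P))) ≤ N2 := by
    intro X Y hN P hP
    have h := injected_le_treeBR_node_top hq1 X Y (e₀ := s₁) (T := T2) hT2b hP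
    rw [hN] at h
    exact h
  have o3 : ∀ (X Y : SumTree), treeBR q (.node X Y) (insert s₁ T3) = N3 → ∀ P, P ⊆ T3 →
      w + (treeBR q X (insert s₁ P) + treeBR q Y (insert (s₁ - q) (T3 \ P))) ≤ N3 := by
    intro X Y hN P hP
    have h := injected_le_treeBR_node_top hq1 X Y (e₀ := s₁) (T := T3) hT3b hP
    rw [hN] at h
    exact h
  have oSab := oS A B rfl
  have oSba := oS B A (treeBR_node_comm A B _)
  have o2ab := o2 A B (by rw [hT2top])
  have o2ba := o2 B A (by rw [hT2top, treeBR_node_comm])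
  have o3ab := o3 A B (by rw [hT3top])
  have o3ba := o3 B A (by rw [hT3top, treeBR_node_comm])
  -- the bound `R` on the options of the left coordinate
  set R : ℚ := ((1 - u) * NS + N2 + u * N3 - 1) / 2 with hRdef
  have hNS1 : 1 ≤ NS := by
    have h := oSab S subset_rfl
    linarith only [h, n0 A (insert 0 S), n0 B (insert (-(q : ℤ)) (S \ S))]
  have hN2w : w ≤ N2 := by
    have h := o2ab T2 subset_rfl
    linarith only [h, n0 A (insert s₁ T2), n0 B (insert (s₁ - q) (T2 \ T2))]
  have hR : 0 ≤ R := by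
    rw [hRdef]
    have h1 : (1 - u) * 1 ≤ (1 - u) * NS := mul_le_mul_of_nonneg_left hNS1 (by linarith only [hu1])
    have h2 : 0 ≤ u * N3 := mul_nonneg hu0.le (n0 _ _)
    have : 0 ≤ (1 - u) * NS + N2 + u * N3 - 1 := by linarith only [h1, h2, hN2w, hwu, hu0]
    linarith only [this]
  ------------------------------------------------------------------ the branch analysis (one orientation)
  have core : ∀ (X Y : SumTree),
      2 * treeBR q X (insert (-1) S) ≤ (1 - u) * treeBR q X (insert 0 S) +
          treeBR q X (insert (e - q) (insert (-(q : ℤ)) S)) + u * treeBR q X (insert (e - q) S) →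
      (∀ P, P ⊆ S → 1 + (treeBR q X (insert 0 P) + treeBR q Y (insert (-(q : ℤ)) (S \ P))) ≤ NS) →
      (∀ P, P ⊆ T2 → w + (treeBR q X (insert s₁ P) + treeBR q Y (insert (s₁ - q) (T2 \ P))) ≤ N2) →
      (∀ P, P ⊆ T2 → w + (treeBR q Y (insert s₁ P) + treeBR q X (insert (s₁ - q) (T2 \ P))) ≤ N2) →
      (∀ P, P ⊆ T3 → w + (treeBR q X (insert s₁ P) + treeBR q Y (insert (s₁ - q) (T3 \ P))) ≤ N3) →
      (∀ P, P ⊆ T3 → w + (treeBR q Y (insert s₁ P) + treeBR q X (insert (s₁ - q) (T3 \ P))) ≤ N3) →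
      ∀ P, P ⊆ S → treeBR q X (insert (-1) P) + treeBR q Y (insert (-1 - (q : ℤ)) (S \ P)) ≤ R := by
    intro X Y ihX oS1 o2xy o2yx o3xy o3yx P hP
    rw [hRdef]
    by_cases hPS : P = S
    · ---------------------------------------------------------------- branch `K = S`
      subst hPS
      have o1 := oS1 P subset_rfl
      have o2' := o2xy T2 subset_rfl
      have o3' := o3xy T3 subset_rfl
      rw [Finset.sdiff_self, Finset.insert_empty, treeBR_single_shift, ← huz] at o1
      rw [Finset.sdiff_self, Finset.insert_empty, treeBR_single_shift, p_s₁q, hT2top] at o2'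
      rw [Finset.sdiff_self, Finset.insert_empty, treeBR_single_shift, p_s₁q, hT3top] at o3'
      rw [Finset.sdiff_self, Finset.insert_empty, treeBR_single_shift, p_m1q]
      have b := phiU_all hu0 hwu hτw hτ4 o1 o2' o3' (rowPhi_of_le ihX) (n0 Y {0})
      linarith only [b]
    by_cases hP0 : P = ∅
    · ---------------------------------------------------------------- branch `K = ∅`
      subst hP0
      have o1 := oS1 ∅ (Finset.empty_subset _)
      rw [Finset.insert_empty, Finset.sdiff_empty] at o1
      -- `Y` keeps `S ∖ s₁` (and the top `s₁`), `X` gets `{s₁-q, e-q, -q}`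
      have o2' := o2yx (S.erase s₁) (by
        rw [hT2]; exact (Finset.subset_insert _ _).trans (Finset.subset_insert _ _))
      have e2 : T2 \ S.erase s₁ = {e - (q : ℤ), -(q : ℤ)} := by
        rw [hT2]
        have h1 : e - (q : ℤ) ∉ S.erase s₁ := fun h => by have := hS _ (Finset.mem_erase.1 h).2; omega
        have h2 : -(q : ℤ) ∉ S.erase s₁ := fun h => by have := hS _ (Finset.mem_erase.1 h).2; omega
        rw [Finset.insert_sdiff_of_notMem _ h1, Finset.insert_sdiff_of_notMem _ h2, Finset.sdiff_self]
        rfl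
      have eJK : treeBR q X (insert (s₁ - q) ({e - (q : ℤ), -(q : ℤ)} : Finset ℤ)) =
          u * treeBR q X {s₁, e, 0} := by
        have : (insert (s₁ - q) ({e - (q : ℤ), -(q : ℤ)} : Finset ℤ)) = {s₁ + -(q : ℤ), e + -(q : ℤ), 0 + -(q : ℤ)} := by
          ext z; simp only [Finset.mem_insert, Finset.mem_singleton]; omega
        rw [this, treeBR_triple_shift', huz]
      rw [Finset.insert_erase hs₁S, e2, eJK] at o2'
      -- `Y` keeps `{e-q} ∪ S ∖ s₁`, `X` gets `{s₁-q, -q}`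
      have o3' := o2yx (insert (e - q) (S.erase s₁)) (by
        rw [hT2]; exact Finset.insert_subset_insert _ (Finset.subset_insert _ _))
      have e3 : T2 \ insert (e - q) (S.erase s₁) = {-(q : ℤ)} := by
        rw [hT2]
        have h2 : -(q : ℤ) ∉ insert (e - (q : ℤ)) (S.erase s₁) := by
          rw [Finset.mem_insert, not_or]
          exact ⟨by omega, fun h => by have := hS _ (Finset.mem_erase.1 h).2; omega⟩
        rw [Finset.insert_sdiff_insert, Finset.insert_sdiff_of_notMem _ h2,
          Finset.sdiff_insert_of_notMem (fun h => by have := hS _ (Finset.mem_erase.1 h).2; omega),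
          Finset.sdiff_self]
        rfl
      have e0s : treeBR q X (insert (s₁ - q) ({-(q : ℤ)} : Finset ℤ)) = u * treeBR q X {s₁, 0} := by
        have : (insert (s₁ - q) ({-(q : ℤ)} : Finset ℤ)) = {s₁ + -(q : ℤ), 0 + -(q : ℤ)} := by
          ext z; simp only [Finset.mem_insert, Finset.mem_singleton]; omega
        rw [this, treeBR_pair_shift', huz]
      rw [Finset.insert_comm, Finset.insert_erase hs₁S, e3, e0s] at o3'
      -- `Y` keeps `S ∖ s₁` in the third coordinate, `X` gets `{s₁-q, e-q}`
      have o4' := o3yx (S.erase s₁) (by rw [hT3]; exact Finset.subset_insert _ _)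
      have e4 : T3 \ S.erase s₁ = {e - (q : ℤ)} := by
        rw [hT3]
        have h1 : e - (q : ℤ) ∉ S.erase s₁ := fun h => by have := hS _ (Finset.mem_erase.1 h).2; omega
        rw [Finset.insert_sdiff_of_notMem _ h1, Finset.sdiff_self]
        rfl
      have eKJ : treeBR q X (insert (s₁ - q) ({e - (q : ℤ)} : Finset ℤ)) = u * τ * treeBR q X {s₁ - e, 0} := by
        have : (insert (s₁ - q) ({e - (q : ℤ)} : Finset ℤ)) = {s₁ - e + (e - (q : ℤ)), 0 + (e - (q : ℤ))} := by
          ext z; simp only [Finset.mem_insert, Finset.mem_singleton]; omega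
        rw [this, treeBR_pair_shift', p_eq]; ring
      rw [Finset.insert_erase hs₁S, e4, eKJ] at o4'
      -- rows on `Y`: (MC) at `{-1-q} ∪ S`, gap convexity below `S`; (M) on `X`
      have rMC := two_treeBR_insert_le hq1 Y (C := S) (i := -1 - (q : ℤ))
        (fun c hc => by have := hS c hc; omega)
      rw [show (-1 - (q : ℤ)) + 1 = -(q : ℤ) by ring] at rMC
      have rGC := treeBR_gc_insert hq1 Y (C := S) he hS
      have rM1 : treeBR q X {0} ≤ treeBR q X {s₁, e, 0} :=
        treeBR_le_of_subset_of_bounds hq1 X (lo := 1 - (q : ℤ)) (by intro z hz; simp at hz ⊢; omega)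
          (by intro z hz; simp only [Finset.mem_insert, Finset.mem_singleton] at hz; omega)
      have rM2 : treeBR q X {0} ≤ treeBR q X {s₁, 0} :=
        treeBR_le_of_subset_of_bounds hq1 X (lo := 1 - (q : ℤ)) (by intro z hz; simp at hz ⊢; omega)
          (by intro z hz; simp only [Finset.mem_insert, Finset.mem_singleton] at hz; omega)
      rw [Finset.insert_empty, Finset.sdiff_empty, treeBR_single_shift, p_half]
      have b := phiU_empty hu0 hwu hτw hτ4 o1 o2' o3' o4' (row_of_le2 rMC) rGC (row_of_le rM1) (row_of_le rM2)
        (n0 X {s₁ - e, 0})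
      linarith only [b]
    ---------------------------------------------------------------- `∅ ≠ K ≠ S`
    have hPne : P.Nonempty := Finset.nonempty_iff_ne_empty.2 hP0
    have hPS' : P ⊂ S := Finset.ssubset_iff_subset_ne.2 ⟨hP, hPS⟩
    have hCne : (S \ P).Nonempty := Finset.sdiff_nonempty.2 fun h => hPS (Finset.Subset.antisymm hP h)
    have hPb : ∀ s ∈ P, 1 - (q : ℤ) ≤ s ∧ s + 1 ≤ e := fun s hs => hS s (hP hs)
    have hCb : ∀ c ∈ S \ P, 1 - (q : ℤ) ≤ c ∧ c + 1 ≤ e := fun c hc => hS c (Finset.mem_sdiff.1 hc).1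
    have hnq : -(q : ℤ) ∉ S := fun h => by have := hS _ h; omega
    have hneq : e - (q : ℤ) ∉ S := fun h => by have := hS _ h; omega
    -- (MC) below the complement, on `Y`
    have rMC := two_treeBR_insert_le hq1 Y (C := S \ P) (i := -1 - (q : ℤ))
      (fun c hc => by have := hCb c hc; omega)
    rw [show (-1 - (q : ℤ)) + 1 = -(q : ℤ) by ring] at rMC
    have o1 := oS1 P hP
    by_cases hs₁P : s₁ ∈ P
    · ---------------------------------------------------------------- branch `max S ∈ K`
      -- the complement lies strictly below `s₁`, and `s₁ ≥ 2 - q`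
      have hCb' : ∀ c ∈ S \ P, 1 - (q : ℤ) ≤ c ∧ c + 1 ≤ s₁ := by
        intro c hc
        have h := Finset.mem_sdiff.1 hc
        have h1 := hS c h.1
        have h2 := hs₁max c h.1
        have h3 : c ≠ s₁ := fun h' => h.2 (h' ▸ hs₁P)
        omega
      have hs₁2 : 2 - (q : ℤ) ≤ s₁ := by
        obtain ⟨c, hc⟩ := hCne
        have := hCb' c hc; omega
      have hwu4 : 4 * u ≤ w := by
        have h1 : (2 : ℚ) ^ (-(q : ℤ) + 2) ≤ (2 : ℚ) ^ s₁ := zpow_le_zpow_right₀ (by norm_num) (by omega)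
        have h2 : (2 : ℚ) ^ (-(q : ℤ) + 2) = 4 * u := by
          rw [pw, huz, show (2 : ℚ) ^ (2 : ℤ) = 4 by norm_num]; ring
        rw [hwdef]; linarith only [h1, h2]
      -- options: `X` keeps `{e-q, -q} ∪ K` resp. `{e-q} ∪ K`, `Y` gets `{s₁-q} ∪ C`
      have o2' := o2xy (insert (e - q) (insert (-(q : ℤ)) (P.erase s₁))) (by
        rw [hT2]
        exact Finset.insert_subset_insert _ (Finset.insert_subset_insert _ (Finset.erase_subset_erase _ hP)))
      have e2 : T2 \ insert (e - q) (insert (-(q : ℤ)) (P.erase s₁)) = S \ P := by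
        rw [hT2]; exact sdiff_keep_top₂ hs₁P hneq hnq
      rw [← insert_insert_eq P hs₁P, e2] at o2'
      have o3' := o3xy (insert (e - q) (P.erase s₁)) (by
        rw [hT3]; exact Finset.insert_subset_insert _ (Finset.erase_subset_erase _ hP))
      have e3 : T3 \ insert (e - q) (P.erase s₁) = S \ P := by
        rw [hT3]; exact sdiff_keep_top₁ hs₁P hneq
      rw [← insert_negq_eq P hs₁P, e3] at o3'
      -- rows: `Φ(K; e)` on `X` (set induction), gap convexity and (M) on `Y`
      have rPhi := ihS P hPS' e he hPb hPne X
      have rGC := treeBR_gc_insert hq1 Y (C := S \ P) (e := s₁) (by omega) hCb'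
      have rM : treeBR q Y (S \ P) ≤ treeBR q Y (insert (s₁ - q) (S \ P)) :=
        treeBR_le_of_subset_of_bounds hq1 Y (Finset.subset_insert _ _) (lo := s₁ - (q : ℤ))
          (fun c hc => by
            rcases Finset.mem_insert.1 hc with rfl | hc
            · omega
            · have := hCb' c hc; omega)
      have b := phiU_top hu0 hwu4 hτw hτ4 o1 o2' o3' (rowPhi_of_le rPhi) (row_of_le2 rMC) rGC (row_of_le rM)
      linarith only [b]
    · ---------------------------------------------------------------- branch `max S ∉ K ≠ ∅`
      have hs₁C : s₁ ∈ S \ P := Finset.mem_sdiff.2 ⟨hs₁S, hs₁P⟩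
      have hPb' : ∀ k ∈ P, 1 - (q : ℤ) ≤ k ∧ k + 1 ≤ s₁ := by
        intro k hk
        have h1 := hS k (hP hk)
        have h2 := hs₁max k (hP hk)
        have h3 : k ≠ s₁ := fun h' => hs₁P (h' ▸ hk)
        omega
      -- options: `Y` keeps `{e-q} ∪ C` (top `s₁ ∈ C`), `X` gets `{s₁-q, -q} ∪ K` resp. `{s₁-q} ∪ K`
      have hsub : (S \ P).erase s₁ ⊆ S.erase s₁ := Finset.erase_subset_erase _ Finset.sdiff_subset
      have o2' := o2yx (insert (e - q) ((S \ P).erase s₁)) (by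
        rw [hT2]
        exact Finset.insert_subset_insert _ (hsub.trans (Finset.subset_insert _ _)))
      have e2 : T2 \ insert (e - q) ((S \ P).erase s₁) = insert (-(q : ℤ)) P := by
        rw [hT2]; exact sdiff_drop_top₂ hs₁P hP hneq hnq (by omega)
      rw [← insert_negq_eq (S \ P) hs₁C, e2] at o2'
      have o3' := o3yx (insert (e - q) ((S \ P).erase s₁)) (by
        rw [hT3]; exact Finset.insert_subset_insert _ hsub)
      have e3 : T3 \ insert (e - q) ((S \ P).erase s₁) = P := by
        rw [hT3]; exact sdiff_drop_top₁ hs₁P hP hneq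
      rw [← insert_negq_eq (S \ P) hs₁C, e3] at o3'
      -- rows: `Φ(K; s₁)` on `X` (set induction), gap convexity and (M) on `Y`
      have rPhi := ihS P hPS' s₁ (by omega) hPb' hPne X
      have rGC := treeBR_gc_insert hq1 Y (C := S \ P) (e := e) he hCb
      have rM : treeBR q Y (S \ P) ≤ treeBR q Y (insert (e - q) (S \ P)) :=
        treeBR_le_of_subset_of_bounds hq1 Y (Finset.subset_insert _ _) (lo := e - (q : ℤ))
          (fun c hc => by
            rcases Finset.mem_insert.1 hc with rfl | hc
            · omega
            · have := hCb c hc; omega)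
      have b := phiU_low hu0 hwu hτw hτ4 o1 o2' o3' (rowPhi_of_le rPhi) (row_of_le2 rMC) rGC (row_of_le rM)
      linarith only [b]
  ------------------------------------------------------------------ assembling the node
  have key := treeBR_node_le_top hq1 A B (e₀ := -1) (T := S) hSm1 hR (fun P hP =>
    ⟨core A B ihA oSab o2ab o2ba o3ab o3ba P hP, core B A ihB oSba o2ba o2ab o3ba o3ab P hP⟩)
  rw [p_half, hRdef] at key
  linarith only [key]

end PhiAll

end Summit.Ventures.CertifiedArithmetic.LowPrec.Opt
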